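import Mathlib

/-!
# Manin–Gamma cell (pub-manin-gamma0): `|G / nG| = |G[n]|` for a finite abelian group (seat p1, gen 2)

Used in `proofs/T1_lead.md` Prop. 4.6 (K): for `G = E(ℚ)_tors` (finite abelian) with `E[2] ⊆ E(ℚ)`, i.e.
`|G[2]| = 4`, the Kummer group `𝒦 ≅ G/2G` has order EXACTLY `4`.  We prove the general statement: for any
endomorphism `f` of a finite abelian group, `|G / f(G)| = |ker f|` (both equal `|G| / |f(G)|`), and record
the instances `f = n • _`.

* `ManinGamma.TorsionCount.card_quotient_range_eq_card_ker`
* `ManinGamma.TorsionCount.card_quotient_nsmul_eq_card_torsion`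
* `ManinGamma.TorsionCount.card_quotient_two_eq_four`  — the form used in Prop. 4.6 (K).
Only Mathlib is imported; no `sorry`.
-/

namespace ManinGamma.TorsionCount

variable {G : Type*} [AddCommGroup G] [Finite G]

/-- For an endomorphism `f` of a finite abelian group, `|G ⧸ f(G)| = |ker f|`. -/
theorem card_quotient_range_eq_card_ker (f : G →+ G) :
    Nat.card (G ⧸ f.range) = Nat.card f.ker := by
  have h1 := AddSubgroup.card_eq_card_quotient_mul_card_addSubgroup f.range
  have h2 := AddSubgroup.card_eq_card_quotient_mul_card_addSubgroup f.ker
  have h3 : Nat.card (G ⧸ f.ker) = Nat.card f.range :=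
    Nat.card_congr (QuotientAddGroup.quotientKerEquivRange f).toEquiv
  have hpos : 0 < Nat.card f.range := Nat.card_pos
  rw [h3] at h2
  have h : Nat.card (G ⧸ f.range) * Nat.card f.range = Nat.card f.ker * Nat.card f.range := by
    calc Nat.card (G ⧸ f.range) * Nat.card f.range = Nat.card G := h1.symm
      _ = Nat.card f.range * Nat.card f.ker := h2
      _ = Nat.card f.ker * Nat.card f.range := by ring
  exact Nat.eq_of_mul_eq_mul_right hpos h

/-- `|G ⧸ nG| = |G[n]|` for a finite abelian group `G` and `n : ℕ`. -/
theorem card_quotient_nsmul_eq_card_torsion (n : ℕ) :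
    Nat.card (G ⧸ (nsmulAddMonoidHom (α := G) n).range) =
      Nat.card (nsmulAddMonoidHom (α := G) n).ker :=
  card_quotient_range_eq_card_ker _

/-- Prop. 4.6 (K) of `proofs/T1_lead.md`: if the `2`-torsion of the finite abelian group `G` has exactly `4`
elements, then `G ⧸ 2G` has exactly `4` elements. -/
theorem card_quotient_two_eq_four
    (h : Nat.card (nsmulAddMonoidHom (α := G) 2).ker = 4) :
    Nat.card (G ⧸ (nsmulAddMonoidHom (α := G) 2).range) = 4 := by
  rw [card_quotient_nsmul_eq_card_torsion, h]

omit [Finite G] in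
/-- Unfolding: `g ∈ ker (n • _) ↔ n • g = 0` and `g ∈ range (n • _) ↔ ∃ h, n • h = g`. -/
theorem mem_ker_nsmul_iff (n : ℕ) (g : G) :
    g ∈ (nsmulAddMonoidHom (α := G) n).ker ↔ n • g = 0 := Iff.rfl

omit [Finite G] in
/-- Unfolding of the range of `n • _`. -/
theorem mem_range_nsmul_iff (n : ℕ) (g : G) :
    g ∈ (nsmulAddMonoidHom (α := G) n).range ↔ ∃ h : G, n • h = g := Iff.rfl

end ManinGamma.TorsionCount
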